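import Literature.NumberTheory.GaloisRepresentations.LAdicCharacterIdelicValuesProofs
import Literature.NumberTheory.GaloisRepresentations.LAdicCharacterIdelicProofs
import Literature.NumberTheory.GaloisRepresentations.LocalKroneckerWeberInertiaProofs
import Literature.NumberTheory.GaloisRepresentations.CyclotomicCharacterFrobeniusProofs
import Literature.NumberTheory.GaloisRepresentations.OrdinaryGaloisRep
import Literature.NumberTheory.GaloisRepresentations.ModNCyclotomicCharacter
import HarnessLib

/-!
# The twisted determinant `(det ρ · ε^{1-k})^m` of an ordinary `ρ` and Serre's product formula

For `ρ : Γ_K → GL₂(ℚ̄_p)` and `k, m`, the continuous character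
`ψ = twistedDetPow p ρ k m : σ ↦ det ρ(σ)^m · ε(σ)^{-(k-1)m}` (`ε` the `p`-adic cyclotomic
character) is TRIVIAL on the inertia at every `v ∣ p` at which `ρ` is ordinary of weight `k` with
exponent `m` (`IsOrdinaryOfWeightAt`: `ρ|_{I_v} ≅ (θ₁ ∗; 0 θ₂)`, `θ₁^m = ε^{(k-1)m}`, `θ₂^m = 1`),
unramified wherever `ρ` is away from `p`, and takes the value `det ρ(Frob_w)^m q_w^{-(k-1)m}` at an
arithmetic Frobenius (`ε(Frob_w) = q_w`).

**Finite order in disguise** (`exists_pow_prod_frobValue_pow_eq_one`).  For ANY continuous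
`ψ : Γ_K → ℚ̄_pˣ` unramified outside a finite set `S` of places NOT above `p`, the tree's global
class field theory (`FramedGaloisRep.exists_idelicCharacter`: the idele class character `Ψ` of
`ψ`, Tate VII §5; `IdelicCharacter.exists_pow_prod_map_localUnits_eq`: Serre's product formula,
*Abelian ℓ-adic representations* III §2.3) gives `N ≥ 1` with
`(∏_{w ∈ T} ψ(Frob_w)^{ord_w u})^N = 1` for every `u ∈ Kˣ` that is a unit at `S` and every finite
`T ⊇ supp(u) ∖ S` disjoint from `S` — i.e. `ψ` has finite order on the subgroup generated by the
Frobenius elements of principal ideals prime to `S`, which is all the diamond-weight computation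
needs (no finiteness of the class group is invoked).

## References

* J.-P. Serre, *Abelian ℓ-adic representations and elliptic curves* (1968), Ch. III §2.3 (locally
  algebraic characters; the product formula over the `S`-units). [SerreAbelianLadic1968]
* C. M. Skinner, A. J. Wiles, Publ. Math. IHÉS 89 (1999), §1 (ordinary: `det ρ = ψ ε^{k-1}`,
  `ψ` of finite order). [SkinnerWiles1999]
-/

open Literature.NumberTheory.GaloisRepresentations
open NumberField IsDedekindDomain Field Polynomial

namespace Literature.NumberTheory.GaloisRepresentations

noncomputable section

variable {K : Type} [Field K] (p : ℕ) [Fact p.Prime]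

/-! ### The cyclotomic character with `ℚ̄_p`-coefficients and the twisted determinant -/

/-- `algebraMap ℤ_p ℚ̄_p` is continuous. [folklore] -/
theorem continuous_algebraMap_padicInt_padicAlgCl : Continuous (algebraMap ℤ_[p] (PadicAlgCl p)) := by
  have h : (algebraMap ℤ_[p] (PadicAlgCl p) : ℤ_[p] → PadicAlgCl p) =
      (algebraMap ℚ_[p] (PadicAlgCl p)) ∘ ((↑) : ℤ_[p] → ℚ_[p]) :=
    funext fun x => IsScalarTower.algebraMap_apply ℤ_[p] ℚ_[p] (PadicAlgCl p) x
  rw [h]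
  exact (continuous_algebraMap ℚ_[p] (PadicAlgCl p)).comp continuous_subtype_val

variable (K) in
/-- The `p`-adic cyclotomic character with values in `ℚ̄_pˣ`. [folklore] -/
def cyclotomicPadicAlgCl : absoluteGaloisGroup K →ₜ* (PadicAlgCl p)ˣ :=
  ContinuousMonoidHom.comp
    ⟨Units.map (algebraMap ℤ_[p] (PadicAlgCl p) : ℤ_[p] →* PadicAlgCl p),
      Continuous.units_map _ (continuous_algebraMap_padicInt_padicAlgCl p)⟩
    (GaloisRep.cyclotomicCharacter K p)

/-- Values of `cyclotomicPadicAlgCl`. [folklore] -/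
theorem coe_cyclotomicPadicAlgCl_apply (σ : absoluteGaloisGroup K) :
    ((cyclotomicPadicAlgCl K p σ : (PadicAlgCl p)ˣ) : PadicAlgCl p) =
      algebraMap ℚ_[p] (PadicAlgCl p) (((GaloisRep.cyclotomicCharacter K p σ : ℤ_[p]ˣ) : ℤ_[p]) : ℚ_[p]) :=
  IsScalarTower.algebraMap_apply ℤ_[p] ℚ_[p] (PadicAlgCl p) _

/-- **The twisted determinant** `ψ(σ) = det ρ(σ)^m · ε(σ)^{-(k-1)m}` of a rank-two `ρ`, a continuous
character `Γ_K → ℚ̄_pˣ` (`= (det ρ · ε^{1-k})^m`). [folklore] -/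
def twistedDetPow (ρ : FramedGaloisRep K (PadicAlgCl p) 2) (k m : ℕ) :
    absoluteGaloisGroup K →ₜ* (PadicAlgCl p)ˣ where
  toFun σ := FramedRep.det ρ σ ^ m * (cyclotomicPadicAlgCl K p σ ^ ((k - 1) * m))⁻¹
  map_one' := by simp
  map_mul' σ τ := by
    simp only [map_mul, mul_pow, mul_inv]
    exact mul_mul_mul_comm _ _ _ _
  continuous_toFun :=
    (((FramedRep.det ρ).continuous).pow m).mul (((cyclotomicPadicAlgCl K p).continuous.pow _).inv)

/-- Unfolding `twistedDetPow`. [folklore] -/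
theorem twistedDetPow_apply (ρ : FramedGaloisRep K (PadicAlgCl p) 2) (k m : ℕ) (σ : absoluteGaloisGroup K) :
    twistedDetPow p ρ k m σ = FramedRep.det ρ σ ^ m * (cyclotomicPadicAlgCl K p σ ^ ((k - 1) * m))⁻¹ :=
  rfl

/-- `ofCharacter ψ σ = 1 ↔ ψ σ = 1` (rank-one framed representation of a character, the tree's
`FramedRep.ofCharacter`). [folklore] -/
theorem ofCharacter_apply_eq_one_iff (ψ : absoluteGaloisGroup K →ₜ* (PadicAlgCl p)ˣ) (σ : absoluteGaloisGroup K) :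
    FramedRep.ofCharacter ψ σ = 1 ↔ ψ σ = 1 := by
  constructor
  · intro h
    have := congrArg (fun M : GL (Fin 1) (PadicAlgCl p) => (M : Matrix (Fin 1) (Fin 1) (PadicAlgCl p)) 0 0) h
    simp only [FramedRep.ofCharacter_apply_coe, Units.val_one, Matrix.one_apply_eq] at this
    exact Units.ext this
  · intro h
    change FramedRep.unitsContinuousMulEquivOfUnique (Fin 1) (PadicAlgCl p) (ψ σ) = 1
    rw [h, map_one]

/-! ### Ordinarity kills the twisted determinant on inertia above `p` -/

variable [NumberField K]

/-- **On the inertia at an ordinary place the twisted determinant is trivial**: if `ρ` is ordinary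
of weight `k` with exponent `m` at `v` (`ρ|_{I_v} ≅ (θ₁ ∗; 0 θ₂)`, `θ₁^m = ε^{(k-1)m}`, `θ₂^m = 1`),
then `det ρ(σ)^m = ε(σ)^{(k-1)m}` for `σ ∈ I_{K_v}`. [folklore] -/
theorem twistedDetPow_eq_one_of_mem_absInertia {ρ : FramedGaloisRep K (PadicAlgCl p) 2}
    {v : HeightOneSpectrum (𝓞 K)} {k m : ℕ} (hord : ρ.IsOrdinaryOfWeightAt p v k m)
    {σ : absoluteGaloisGroup (v.adicCompletion K)} (hσ : σ ∈ absInertia (v.adicCompletion K)) :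
    twistedDetPow p ρ k m (absGaloisRestrict K (v.adicCompletion K) σ) = 1 := by
  obtain ⟨Q, hQ⟩ := (FramedGaloisRep.isOrdinaryOfWeightAt_iff_padicAlgCl p ρ v k m).1 hord
  obtain ⟨h11, h00⟩ := (hQ σ).2 hσ
  have h10 := (hQ σ).1
  haveI : NeZero (p : K) := ⟨Nat.cast_ne_zero.mpr (Fact.out : p.Prime).ne_zero⟩
  set c : PadicAlgCl p := algebraMap ℚ_[p] (PadicAlgCl p)
    (((GaloisRep.cyclotomicCharacter (v.adicCompletion K) p σ : ℤ_[p]ˣ) : ℤ_[p]) : ℚ_[p]) with hc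
  have hc0 : c ≠ 0 := by
    rw [hc, map_ne_zero_iff _ (algebraMap ℚ_[p] (PadicAlgCl p)).injective, PadicInt.coe_ne_zero]
    exact Units.ne_zero _
  have hdet : ((FramedRep.det ρ (absGaloisRestrict K (v.adicCompletion K) σ) : (PadicAlgCl p)ˣ) :
      PadicAlgCl p) ^ m = c ^ ((k - 1) * m) := by
    rw [FramedRep.det_apply, Matrix.GeneralLinearGroup.val_det_apply]
    change ((ρ.toLocal v σ : GL (Fin 2) (PadicAlgCl p)) : Matrix (Fin 2) (Fin 2) (PadicAlgCl p)).det ^ m = _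
    have hconj : ((ρ.toLocal v σ : GL (Fin 2) (PadicAlgCl p)) : Matrix (Fin 2) (Fin 2) (PadicAlgCl p)).det =
        ((Q⁻¹ * ρ.toLocal v σ * Q : GL (Fin 2) (PadicAlgCl p)) : Matrix (Fin 2) (Fin 2) (PadicAlgCl p)).det := by
      rw [Units.val_mul, Units.val_mul, Matrix.det_units_conj']
    rw [hconj, Matrix.det_fin_two, h10, mul_zero, sub_zero, mul_pow, h00, h11, mul_one]
  have hcyc : ((cyclotomicPadicAlgCl K p (absGaloisRestrict K (v.adicCompletion K) σ) : (PadicAlgCl p)ˣ) :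
      PadicAlgCl p) = c := by
    rw [coe_cyclotomicPadicAlgCl_apply, cyclotomicCharacter_absGaloisRestrict]
  apply Units.ext
  rw [twistedDetPow_apply, Units.val_mul, Units.val_pow_eq_pow_val, hdet, Units.val_inv_eq_inv_val,
    Units.val_pow_eq_pow_val, hcyc, Units.val_one, mul_inv_cancel₀ (pow_ne_zero _ hc0)]

/-- **The twisted determinant of an ordinary `ρ` is unramified at the ordinary places above `p`**
(local–global compatibility of unramifiedness, `GaloisRep.isUnramifiedAt_iff_toLocal_holds`).
[folklore] -/
theorem isUnramifiedAt_twistedDetPow_of_isOrdinaryOfWeightAt {ρ : FramedGaloisRep K (PadicAlgCl p) 2}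
    {v : HeightOneSpectrum (𝓞 K)} {k m : ℕ} (hord : ρ.IsOrdinaryOfWeightAt p v k m) :
    FramedGaloisRep.IsUnramifiedAt v (FramedRep.ofCharacter (twistedDetPow p ρ k m)) := by
  rw [← FramedGaloisRep.isUnramifiedAt_toGaloisRep_iff]
  refine (GaloisRep.isUnramifiedAt_iff_toLocal_holds v _).mpr fun τ hτ => ?_
  rw [GaloisRep.toLocal_apply]
  exact (FramedRep.toContinuousRep_apply_eq_one_iff _ _).mpr
    ((ofCharacter_apply_eq_one_iff p _ _).2 (twistedDetPow_eq_one_of_mem_absInertia p hord hτ))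

/-- Away from `p`, the twisted determinant is unramified wherever `ρ` is (the cyclotomic character
being unramified away from `p`). [folklore] -/
theorem isUnramifiedAt_twistedDetPow_of_isUnramifiedAt {ρ : FramedGaloisRep K (PadicAlgCl p) 2}
    {w : HeightOneSpectrum (𝓞 K)} (hw : (p : 𝓞 K) ∉ w.asIdeal) (hρ : ρ.IsUnramifiedAt w) (k m : ℕ) :
    FramedGaloisRep.IsUnramifiedAt w (FramedRep.ofCharacter (twistedDetPow p ρ k m)) := by
  intro 𝔓 h𝔓 σ hσ
  rw [ofCharacter_apply_eq_one_iff]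
  have h1 : ρ σ = 1 := hρ 𝔓 h𝔓 σ hσ
  have h2 : GaloisRep.cyclotomicCharacter K p σ = 1 := by
    have h := FramedGaloisRep.det_cyclotomic_apply K p σ
    rw [FramedRep.det_apply, FramedGaloisRep.isUnramifiedAt_cyclotomic_holds K p hw 𝔓 h𝔓 σ hσ, map_one] at h
    exact h.symm
  apply Units.ext
  rw [twistedDetPow_apply, Units.val_mul, Units.val_pow_eq_pow_val, Units.val_inv_eq_inv_val,
    Units.val_pow_eq_pow_val, coe_cyclotomicPadicAlgCl_apply, h2, FramedRep.det_apply, h1, map_one]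
  simp

/-- **The twisted determinant at an arithmetic Frobenius**: `ψ(Frob_w) = det ρ(Frob_w)^m · q_w^{-(k-1)m}`
for `w ∤ p` (`ε(Frob_w) = q_w`). [folklore] -/
theorem coe_twistedDetPow_apply_of_isArithFrobAt (ρ : FramedGaloisRep K (PadicAlgCl p) 2) (k m : ℕ)
    {w : HeightOneSpectrum (𝓞 K)} (hw : (p : 𝓞 K) ∉ w.asIdeal) {𝔓 : Ideal (absIntegers (𝓞 K) K)}
    (h𝔓 : 𝔓 ∈ w.primesAbove) {σ : absoluteGaloisGroup K} (hσ : IsArithFrobAt (𝓞 K) σ 𝔓) :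
    ((twistedDetPow p ρ k m σ : (PadicAlgCl p)ˣ) : PadicAlgCl p) =
      (ρ σ).val.det ^ m * ((w.residueCard : PadicAlgCl p) ^ ((k - 1) * m))⁻¹ := by
  have hc : ((cyclotomicPadicAlgCl K p σ : (PadicAlgCl p)ˣ) : PadicAlgCl p) = w.residueCard := by
    rw [coe_cyclotomicPadicAlgCl_apply, GaloisRep.cyclotomicCharacter_apply_of_isArithFrobAt hw h𝔓 hσ]
    simp
  rw [twistedDetPow_apply, Units.val_mul, Units.val_pow_eq_pow_val, Units.val_inv_eq_inv_val,
    Units.val_pow_eq_pow_val, hc, FramedRep.det_apply, Matrix.GeneralLinearGroup.val_det_apply]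

/-! ### Serre's product formula: finite order on principal Frobenius products -/

/-- **Finite order in disguise.** For a continuous `ψ : Γ_K → ℚ̄_pˣ` unramified outside a finite set
`S` of places none of which lies above `p`, there is `N ≥ 1` such that for every `u ∈ Kˣ` which is a
unit at `S`, every finite `T` disjoint from `S` outside which (and `S`) `u` is a unit, with
`|u|_w = |ϖ_w|^{e_w}` on `T`, and every family `f_w` of FROBENIUS VALUES of `ψ` on `T`:
`(∏_{w ∈ T} f_w^{e_w})^N = 1`.  (The idele class character `Ψ` of `ψ` kills `Kˣ`, the archimedean
squares, the local units off `S`, and a power of the local units at `S`; global class field theory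
as proved in the tree.) [cite: SerreAbelianLadic1968, Ch. III §2.3] -/
theorem exists_pow_prod_frobValue_pow_eq_one [DecidableEq (HeightOneSpectrum (𝓞 K))]
    (ψ : absoluteGaloisGroup K →ₜ* (PadicAlgCl p)ˣ)
    (S : Finset (HeightOneSpectrum (𝓞 K))) (hS : ∀ v ∉ S, FramedGaloisRep.IsUnramifiedAt v (FramedRep.ofCharacter ψ))
    (hSp : ∀ v ∈ S, (p : 𝓞 K) ∉ v.asIdeal) :
    ∃ N : ℕ, 0 < N ∧ ∀ (u : Kˣ) (T : Finset (HeightOneSpectrum (𝓞 K))) (e : HeightOneSpectrum (𝓞 K) → ℕ)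
      (f : HeightOneSpectrum (𝓞 K) → (PadicAlgCl p)ˣ),
      (∀ v ∈ S, v.valuation K (u : K) = 1) → Disjoint S T → (∀ v ∉ S ∪ T, v.valuation K (u : K) = 1) →
      (∀ w ∈ T, Valued.v (algebraMap K (w.adicCompletion K) (u : K)) = WithZero.exp (-(e w : ℤ))) →
      (∀ w ∈ T, ∀ 𝔓 ∈ w.primesAbove, ∀ σ : absoluteGaloisGroup K, IsArithFrobAt (𝓞 K) σ 𝔓 → ψ σ = f w) →
      (∏ w ∈ T, f w ^ e w) ^ N = 1 := by
  classical
  obtain ⟨Ψ, hK, hΨ⟩ := FramedGaloisRep.exists_idelicCharacter (FramedRep.ofCharacter ψ)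
  obtain ⟨N, hN, hmain⟩ := IdelicCharacter.exists_pow_prod_map_localUnits_eq Ψ hK S
    (fun v hv u => (hΨ v (hS v hv)).1 u)
  refine ⟨N, hN, fun u T e f hSu hdisj hout hval hfrob => ?_⟩
  have key := hmain u (fun v hv _ => hSu v hv) T hdisj hout
  have hempty : S.filter (fun v => (p : 𝓞 K) ∈ v.asIdeal) = ∅ :=
    Finset.filter_false_of_mem fun v hv => hSp v hv
  rw [hempty, Finset.prod_empty, one_pow, one_mul] at key
  have hfac : ∀ w ∈ T, Ψ (localUnits w (globalToLocalUnits w u)) = f w ^ e w := by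
    intro w hwT
    have hwS : w ∉ S := fun h => Finset.disjoint_left.1 hdisj h hwT
    obtain ⟨hunits, hfrobΨ⟩ := hΨ w (hS w hwS)
    obtain ⟨π, hπ⟩ := w.valuation_exists_uniformizer K
    have hπv : Valued.v (algebraMap K (w.adicCompletion K) π) = WithZero.exp (-1 : ℤ) :=
      (HeightOneSpectrum.valuedAdicCompletion_eq_valuation' w π).trans hπ
    have hπ0 : algebraMap K (w.adicCompletion K) π ≠ 0 := fun h => by
      rw [h, map_zero] at hπv; exact WithZero.coe_ne_zero hπv.symm
    set ϖ : (w.adicCompletion K)ˣ := Units.mk0 _ hπ0 with hϖdef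
    have hϖ : Valued.v (ϖ : w.adicCompletion K) = WithZero.exp (-1 : ℤ) := by rw [hϖdef, Units.val_mk0]; exact hπv
    rw [IdelicCharacter.map_localUnits_eq_zpow_of_valued Ψ hunits hϖ (globalToLocalUnits w u) (m := (e w : ℤ))
      (by rw [val_globalToLocalUnits]; exact hval w hwT), zpow_natCast]
    congr 1
    obtain ⟨𝔓, h𝔓⟩ := HeightOneSpectrum.primesAbove_nonempty w
    obtain ⟨σ, hσ⟩ := HeightOneSpectrum.exists_isArithFrobAt_of_mem_primesAbove_holds h𝔓
    have hcp := hfrobΨ ϖ hϖ 𝔓 h𝔓 σ hσ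
    rw [FramedRep.charpoly_ofCharacter, hfrob w hwT 𝔓 h𝔓 σ hσ, sub_right_inj] at hcp
    exact (Units.ext (C_injective hcp)).symm
  rw [Finset.prod_congr rfl hfac] at key
  exact key

end

end Literature.NumberTheory.GaloisRepresentations
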